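import Literature.Analysis.FluidPDE.DuchonRobertMollifierKernel
import Literature.Analysis.FluidPDE.DuchonRobertViscousSlice
import HarnessLib

/-!
# Discharge of `Torus.tendsto_viscous_pairing` (Duchon–Robert 2000, proof of Prop. 1: the viscous terms)

`Literature.Analysis.FluidPDE.DuchonRobertLocalBalance` records as the named fact
`Torus.tendsto_viscous_pairing` the limit of the viscous pairing in Duchon–Robert's proof of the
local energy balance (Duchon–Robert 2000, proof of Prop. 1, p. 251: `νΔ(u·u^ε) → νΔ|u|²`,
`ν∇u:∇u^ε → ν|∇u|²` for `u ∈ L²(0,T;H¹)`; cited there to Evans, App. C.4, Thm. 7 (iv) and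
§5.2.1): for a jointly measurable `u ∈ L³((0,T) × T^d)` with a jointly measurable, slice-wise
integrable weak spatial gradient `G ∈ L²`, a mollifier `φ` and a scalar test function `ψ`
supported in `(0,T)`,
`∫₀ᵀ∫ ⟪u, ΔΦ_ε⟫ → ∫₀ᵀ∫ |u|²Δψ − 2∫₀ᵀ∫ |G|²ψ` as `ε → 0⁺`, `Φ_ε = ψ u^{K_ε} + (ψu) ⋆ K_ε`.

This file proves it (`Torus.tendsto_viscous_pairing_holds`):

1. reduce `ε → 0⁺` to sequences `εₙ → 0`, `εₙ > 0` (`Torus.tendsto_nhdsGT_zero_of_seq`);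
2. at a.e. time (where `u(t) ∈ L²`, `G(t)` is an integrable weak gradient of `u(t)`), rewrite the
   pairing by `Torus.integral_inner_laplacian_symmTestField` (`DuchonRobertViscousSlice`) as
   `∑ᵢ ∫ Δψ uᵢ (uᵢ ⋆ K) − 2 ∑ⱼᵢ ∫ ψ (G eⱼ)ᵢ ((G eⱼ)ᵢ ⋆ K)`;
3. each quadratic pairing converges by the `L²` approximate identity on `T^d`
   (`Torus.tendsto_integral_mul_mul_convolution`, `DuchonRobertMollifierKernel`; Evans App. C.4
   Thm. 7 (iv)), the limits summing to `∫ |u|²Δψ − 2∫ |G|²ψ`;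
4. the pairings are dominated by `C(∫ |u(t)|² + ∫ |G(t)|²) ∈ L¹(0,T)` (Young's inequality,
   `Torus.abs_integral_mul_mul_convolution_le`), and they are measurable in time (Fubini), so
   dominated convergence in time concludes.

## References

* J. Duchon, R. Robert, Nonlinearity 13 (2000) 249–255, proof of Prop. 1, p. 251. [DuchonRobert2000]
* L. C. Evans, *Partial Differential Equations*, 2nd ed. (2010), App. C.4 Thm. 7 (iv), §5.2.1,
  §5.3.1 Thm. 1. [Evans2010]
* L. C. Evans, R. F. Gariepy, *Measure Theory and Fine Properties of Functions*, rev. ed. (2015),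
  §4.2.1 Thm. 4.1 (the same mollifier theorem, printed proof consulted). [EvansGariepy2015]
-/

noncomputable section

open MeasureTheory TopologicalSpace Set Function Filter Topology Metric
open scoped ENNReal NNReal Convolution ContDiff InnerProductSpace RealInnerProductSpace

namespace Literature.Analysis.FluidPDE.Torus

variable {d : Type*} [Fintype d] [DecidableEq d]

/-! ## Discharge of `tendsto_viscous_pairing` -/

section Discharge

/-- **Discharge of `Torus.tendsto_viscous_pairing`** (Duchon–Robert 2000, proof of Prop. 1,
p. 251: the viscous terms `νΔ(u·u^ε) → νΔ|u|²`, `ν∇u:∇u^ε → ν|∇u|²`; Evans, *PDE*, App. C.4,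
Thm. 7 (iv): `f^ε → f` in `L^p_loc`, `1 ≤ p < ∞`, and §5.2.1 / §5.3.1 Thm. 1: `∂ⱼ(u^ε) = (∂ⱼu)^ε`
for weak derivatives). Proof: along any sequence `εₙ → 0⁺` (`tendsto_nhdsGT_zero_of_seq`), at
a.e. time the pairing `∫ ⟪u, ΔΦ_ε⟫` equals `∑ᵢ ∫ Δψ uᵢ (uᵢ ⋆ K_ε) − 2 ∑ⱼᵢ ∫ ψ (G eⱼ)ᵢ ((G eⱼ)ᵢ ⋆ K_ε)`
(`integral_inner_laplacian_symmTestField`), which converges to `∫ |u|²Δψ − 2∫ |G|²ψ` by the `L²`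
convergence of mollification on `T^d` (`tendsto_integral_mul_mul_convolution`) and is dominated
by `C(∫ |u(t)|² + ∫ |G(t)|²) ∈ L¹(0,T)` (`abs_integral_mul_mul_convolution_le`, Young); dominated
convergence in time concludes. [cite: Evans2010, App. C.4 Thm. 7 (iv)] -/
theorem tendsto_viscous_pairing_holds : tendsto_viscous_pairing (d := d) := by
  intro T u hmeas hu3 G hGmeas hG hG2 φ hφ ψ hψ
  set μ : Measure ℝ := volume.restrict (Ioo 0 T) with hμ
  have hum : AEStronglyMeasurable (uncurry u) (μ.prod volume) := aestronglyMeasurable_uncurry_prod hmeas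
  -- `u ∈ L²_{t,x}`: slices and the product form
  have hu2 : ∫⁻ t in Ioo 0 T, ∫⁻ x, ‖u t x‖ₑ ^ 2 < ⊤ := by
    refine lt_of_le_of_lt (lintegral_enorm_sq_le hum) (ENNReal.mul_lt_top ?_ ?_)
    · exact ENNReal.rpow_lt_top_of_nonneg (by norm_num) ENNReal.ofReal_ne_top
    · exact ENNReal.rpow_lt_top_of_nonneg (by norm_num) hu3.ne
  have hL2 : ∀ᵐ t ∂μ, MemLp (u t) 2 volume := ae_memLp_two_of_lintegral hum hu2
  have I2 : Integrable (fun z : ℝ × UnitAddTorus d => ‖u z.1 z.2‖ ^ 2) (μ.prod volume) := by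
    have e2 : ∫⁻ t in Ioo 0 T, ∫⁻ x, ‖u t x‖ₑ ^ 2 = ∫⁻ z, ‖u z.1 z.2‖ₑ ^ 2 ∂(μ.prod volume) :=
      lintegral_Ioo_lintegral_eq_lintegral_prod (hum.enorm.pow_const _)
    have hM2 : MemLp (uncurry u) 2 (μ.prod volume) := by
      refine ⟨hum, (eLpNorm_lt_top_iff_lintegral_rpow_enorm_lt_top two_ne_zero
        ENNReal.ofNat_ne_top).2 ?_⟩
      have h2 : ∀ x : ℝ≥0∞, x ^ (2 : ℝ≥0∞).toReal = x ^ (2 : ℕ) := fun x => by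
        rw [ENNReal.toReal_ofNat, ← ENNReal.rpow_natCast]; norm_num
      simpa only [h2, Function.uncurry, ← e2] using hu2
    exact (memLp_two_iff_integrable_sq_norm hum).1 hM2
  -- `G ∈ L²_{t,x}`: slices and the product form
  have hGw : AEMeasurable (fun z : ℝ × UnitAddTorus d => weakGradNormSq (G z.1) z.2) (μ.prod volume) :=
    aemeasurable_weakGradNormSq_uncurry hGmeas
  have Iw : Integrable (fun z : ℝ × UnitAddTorus d => weakGradNormSq (G z.1) z.2) (μ.prod volume) := by
    refine ⟨hGw.aestronglyMeasurable, ?_⟩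
    have h := hG2
    rw [lintegral_Ioo_lintegral_eq_lintegral_prod hGw.ennreal_ofReal] at h
    refine lt_of_le_of_lt (lintegral_mono fun z => le_of_eq ?_) h
    exact Real.enorm_eq_ofReal (weakGradNormSq_nonneg _ _)
  have hIwt : ∀ᵐ t ∂μ, Integrable (fun x => weakGradNormSq (G t) x) volume := Iw.prod_right_ae
  have hGej : ∀ᵐ t ∂μ, ∀ j, MemLp (fun x => G t x (EuclideanSpace.single j 1)) 2 volume := by
    filter_upwards [hIwt, hG] with t ht htG
    intro j
    have hm : AEStronglyMeasurable (fun x => G t x (EuclideanSpace.single j 1)) volume :=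
      (ContinuousLinearMap.apply ℝ (EuclideanSpace ℝ d) (EuclideanSpace.single j 1)).continuous
        |>.comp_aestronglyMeasurable htG.2.aestronglyMeasurable
    refine (memLp_two_iff_integrable_sq_norm hm).2 (ht.mono' (hm.norm.pow 2) (ae_of_all _ fun x => ?_))
    rw [Real.norm_eq_abs, abs_of_nonneg (sq_nonneg _), weakGradNormSq_eq_sum]
    exact Finset.single_le_sum (f := fun j => ‖G t x (EuclideanSpace.single j 1)‖ ^ 2)
      (fun j _ => sq_nonneg _) (Finset.mem_univ j)
  -- the test function: bounds and measurability of `ψ`, `Δψ`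
  obtain ⟨hψs, -, -, hla⟩ := hψ.isSpaceTimeTest.isSmoothSpaceTimeOn_derived
  obtain ⟨⟨Cla, hCla0, hCla⟩, hlam⟩ := hla.bound_and_measurable T
  have hψm : AEStronglyMeasurable (uncurry ψ) (μ.prod volume) := (hψs.bound_and_measurable T).2
  obtain ⟨Cψ, hCψ⟩ := hψ.exists_abs_le
  have hCψ' : ∀ t x, ‖ψ t x‖ ≤ Cψ := fun t x => by rw [Real.norm_eq_abs]; exact hCψ t x
  have hCψ0 : 0 ≤ Cψ := (abs_nonneg _).trans (hCψ 0 0)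
  have hψt : ∀ t, FunctionSpaces.Torus.IsSmooth (ψ t) := hψ.isSpaceTimeTest.isSmooth_slice
  have hIoo : ∀ᵐ t ∂μ, t ∈ Ioo 0 T := ae_restrict_mem measurableSet_Ioo
  have hIoo2 : ∀ᵐ z : ℝ × UnitAddTorus d ∂(μ.prod volume), z.1 ∈ Ioo 0 T := by
    rw [hμ, ← volume_restrict_Ioo_prod_univ]
    filter_upwards [ae_restrict_mem (measurableSet_Ioo.prod MeasurableSet.univ)] with z hz
    exact hz.1
  -- integrability in time of the limit pieces and of the dominating function
  have IL : Integrable (fun t => ∫ x, ‖u t x‖ ^ 2 * FunctionSpaces.Torus.laplacian (ψ t) x) μ := by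
    have h := (I2.mul_bdd hlam (hIoo2.mono fun z hz => hCla z.1 (Ioo_subset_Icc_self hz) z.2))
    exact h.integral_prod_left
  have IG : Integrable (fun t => ∫ x, weakGradNormSq (G t) x * ψ t x) μ := by
    have h := Iw.mul_bdd hψm (ae_of_all _ fun z => hCψ' z.1 z.2)
    exact h.integral_prod_left
  have Iu : Integrable (fun t => ∫ x, ‖u t x‖ ^ 2) μ := I2.integral_prod_left
  have IGn : Integrable (fun t => ∫ x, weakGradNormSq (G t) x) μ := Iw.integral_prod_left
  -- reduction to sequences `εₙ → 0⁺`
  refine tendsto_nhdsGT_zero_of_seq (c := 1) one_pos fun y hy hy0 => ?_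
  have hy' : ∀ n, 0 < y n := fun n => (hy n).1
  have hK : ∀ n, FunctionSpaces.Torus.IsSmooth (mollifierKernel φ (y n)) := fun n =>
    isSmooth_mollifierKernel hφ (hy' n)
  have hKev : ∀ n z, mollifierKernel φ (y n) (-z) = mollifierKernel φ (y n) z := fun n =>
    mollifierKernel_neg hφ (y n)
  have hKc : ∀ n, Continuous (mollifierKernel φ (y n)) := fun n => continuous_mollifierKernel hφ (hy' n)
  -- the functionals
  set F : ℕ → ℝ → ℝ := fun n t => ∫ x, ⟪u t x, FunctionSpaces.Torus.laplacian
    (symmTestField (mollifierKernel φ (y n)) (ψ t) (u t)) x⟫ with hF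
  set S : ℕ → ℝ → ℝ := fun n t =>
    (∑ i, ∫ x, FunctionSpaces.Torus.laplacian (ψ t) x *
      (u t x i * ((fun y => u t y i) ⋆ mollifierKernel φ (y n)) x)) -
      2 * ∑ j, ∑ i, ∫ x, ψ t x * (G t x (EuclideanSpace.single j 1) i *
        ((fun y => G t y (EuclideanSpace.single j 1) i) ⋆ mollifierKernel φ (y n)) x) with hS
  set bound : ℝ → ℝ := fun t => Cla * (∫ x, ‖u t x‖ ^ 2) + 2 * Cψ * ∫ x, weakGradNormSq (G t) x
    with hbound
  have hFS : ∀ᵐ t ∂μ, ∀ n, F n t = S n t := by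
    filter_upwards [hL2, hG] with t ht htG
    intro n
    exact integral_inner_laplacian_symmTestField (ht.integrable one_le_two) htG.1 htG.2 (hK n)
      (hKev n) (hψt t)
  -- measurability in time
  have hSm : ∀ n, AEStronglyMeasurable (S n) μ := by
    intro n
    have hA : AEStronglyMeasurable (fun t => ∑ i, ∫ x, FunctionSpaces.Torus.laplacian (ψ t) x *
        (u t x i * ((fun y => u t y i) ⋆ mollifierKernel φ (y n)) x)) μ :=
      Finset.aestronglyMeasurable_fun_sum _ fun i _ =>
        aestronglyMeasurable_integral_mul_mul_convolution
          (aestronglyMeasurable_uncurry_apply hum i) hlam (hKc n)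
    have hB : AEStronglyMeasurable (fun t => ∑ j, ∑ i, ∫ x, ψ t x *
        (G t x (EuclideanSpace.single j 1) i *
          ((fun y => G t y (EuclideanSpace.single j 1) i) ⋆ mollifierKernel φ (y n)) x)) μ := by
      refine Finset.aestronglyMeasurable_fun_sum _ fun j _ =>
        Finset.aestronglyMeasurable_fun_sum _ fun i _ => ?_
      have hGji : AEStronglyMeasurable
          (uncurry fun t x => G t x (EuclideanSpace.single j 1) i) (μ.prod volume) :=
        ((EuclideanSpace.proj i).comp (ContinuousLinearMap.apply ℝ (EuclideanSpace ℝ d)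
          (EuclideanSpace.single j 1))).continuous.comp_aestronglyMeasurable hGmeas
      exact aestronglyMeasurable_integral_mul_mul_convolution hGji hψm (hKc n)
    exact hA.sub (hB.const_mul 2)
  have hFm : ∀ n, AEStronglyMeasurable (F n) μ := fun n =>
    (hSm n).congr (hFS.mono fun t ht => (ht n).symm)
  -- domination
  have hle : ∀ n, ∀ᵐ t ∂μ, ‖F n t‖ ≤ bound t := by
    intro n
    filter_upwards [hFS, hL2, hGej, hIoo] with t ht hut hGt htI
    rw [ht n, Real.norm_eq_abs]
    have h1 : ∀ i, |∫ x, FunctionSpaces.Torus.laplacian (ψ t) x *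
        (u t x i * ((fun y => u t y i) ⋆ mollifierKernel φ (y n)) x)| ≤
          Cla * ∫ x, u t x i ^ 2 := fun i =>
      abs_integral_mul_mul_convolution_le hφ (hy' n) (hut.eval_piLp i) hCla0
        (hCla t (Ioo_subset_Icc_self htI))
    have h2 : ∀ j i, |∫ x, ψ t x * (G t x (EuclideanSpace.single j 1) i *
        ((fun y => G t y (EuclideanSpace.single j 1) i) ⋆ mollifierKernel φ (y n)) x)| ≤
          Cψ * ∫ x, G t x (EuclideanSpace.single j 1) i ^ 2 := fun j i =>
      abs_integral_mul_mul_convolution_le hφ (hy' n) ((hGt j).eval_piLp i) hCψ0 (hCψ' t)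
    calc |S n t| ≤ |∑ i, ∫ x, FunctionSpaces.Torus.laplacian (ψ t) x *
          (u t x i * ((fun y => u t y i) ⋆ mollifierKernel φ (y n)) x)| +
          |2 * ∑ j, ∑ i, ∫ x, ψ t x * (G t x (EuclideanSpace.single j 1) i *
            ((fun y => G t y (EuclideanSpace.single j 1) i) ⋆ mollifierKernel φ (y n)) x)| :=
          abs_sub _ _
      _ ≤ (∑ i, Cla * ∫ x, u t x i ^ 2) +
          2 * ∑ j, ∑ i, Cψ * ∫ x, G t x (EuclideanSpace.single j 1) i ^ 2 := by
          refine add_le_add ((Finset.abs_sum_le_sum_abs _ _).trans (Finset.sum_le_sum fun i _ => h1 i)) ?_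
          rw [abs_mul, abs_two]
          refine mul_le_mul_of_nonneg_left ((Finset.abs_sum_le_sum_abs _ _).trans
            (Finset.sum_le_sum fun j _ => (Finset.abs_sum_le_sum_abs _ _).trans
              (Finset.sum_le_sum fun i _ => h2 j i))) zero_le_two
      _ = bound t := by
          have e1 : ∑ i, Cla * ∫ x, u t x i ^ 2 = Cla * (∫ x, ‖u t x‖ ^ 2) := by
            rw [← Finset.mul_sum, sum_integral_apply_sq hut]
          have e2 : ∑ j, ∑ i, Cψ * ∫ x, G t x (EuclideanSpace.single j 1) i ^ 2 =
              Cψ * ∫ x, weakGradNormSq (G t) x := by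
            rw [← sum_sum_integral_apply_sq hGt, Finset.mul_sum]
            exact Finset.sum_congr rfl fun j _ => (Finset.mul_sum _ _ _).symm
          rw [e1, e2, hbound]
          ring
  -- pointwise limit
  have hlim : ∀ᵐ t ∂μ, Tendsto (fun n => F n t) atTop
      (𝓝 ((∫ x, ‖u t x‖ ^ 2 * FunctionSpaces.Torus.laplacian (ψ t) x) -
        2 * ∫ x, weakGradNormSq (G t) x * ψ t x)) := by
    filter_upwards [hFS, hL2, hGej, hIoo] with t ht hut hGt htI
    rw [tendsto_congr ht]
    have hlam_t : AEStronglyMeasurable (FunctionSpaces.Torus.laplacian (ψ t)) volume :=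
      (hψt t).laplacian.continuous.aestronglyMeasurable
    have hψ_t : AEStronglyMeasurable (ψ t) volume := (hψt t).continuous.aestronglyMeasurable
    have hClat : ∀ x, ‖FunctionSpaces.Torus.laplacian (ψ t) x‖ ≤ Cla := hCla t (Ioo_subset_Icc_self htI)
    have h1 : Tendsto (fun n => ∑ i, ∫ x, FunctionSpaces.Torus.laplacian (ψ t) x *
        (u t x i * ((fun y => u t y i) ⋆ mollifierKernel φ (y n)) x)) atTop
        (𝓝 (∑ i, ∫ x, FunctionSpaces.Torus.laplacian (ψ t) x * (u t x i * u t x i))) :=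
      tendsto_finsetSum _ fun i _ =>
        tendsto_integral_mul_mul_convolution hφ (hut.eval_piLp i) hlam_t hClat hy' hy0
    have h2 : Tendsto (fun n => ∑ j, ∑ i, ∫ x, ψ t x * (G t x (EuclideanSpace.single j 1) i *
        ((fun y => G t y (EuclideanSpace.single j 1) i) ⋆ mollifierKernel φ (y n)) x)) atTop
        (𝓝 (∑ j, ∑ i, ∫ x, ψ t x *
          (G t x (EuclideanSpace.single j 1) i * G t x (EuclideanSpace.single j 1) i))) :=
      tendsto_finsetSum _ fun j _ => tendsto_finsetSum _ fun i _ =>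
        tendsto_integral_mul_mul_convolution hφ ((hGt j).eval_piLp i) hψ_t (hCψ' t) hy' hy0
    have h := h1.sub (h2.const_mul 2)
    rwa [sum_integral_mul_apply_mul_apply hut hlam_t hClat,
      sum_sum_integral_mul_apply_mul_apply hGt hψ_t (hCψ' t)] at h
  -- dominated convergence in time
  have hval : ((∫ t, (∫ x, ‖u t x‖ ^ 2 * FunctionSpaces.Torus.laplacian (ψ t) x) ∂μ) -
      2 * ∫ t, (∫ x, weakGradNormSq (G t) x * ψ t x) ∂μ) =
      ∫ t, ((∫ x, ‖u t x‖ ^ 2 * FunctionSpaces.Torus.laplacian (ψ t) x) -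
        2 * ∫ x, weakGradNormSq (G t) x * ψ t x) ∂μ := by
    rw [integral_sub IL (IG.const_mul 2), integral_const_mul]
  have Ib : Integrable bound μ := by
    rw [hbound]
    exact (Iu.const_mul Cla).add (IGn.const_mul (2 * Cψ))
  show Tendsto (fun n => ∫ t, F n t ∂μ) atTop
    (𝓝 ((∫ t, (∫ x, ‖u t x‖ ^ 2 * FunctionSpaces.Torus.laplacian (ψ t) x) ∂μ) -
      2 * ∫ t, (∫ x, weakGradNormSq (G t) x * ψ t x) ∂μ))
  rw [hval]
  exact tendsto_integral_of_dominated_convergence bound hFm Ib hle hlim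

end Discharge

end Literature.Analysis.FluidPDE.Torus
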